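import Summits.ValiantsHypothesis.ValiantsHypothesis.Theorems.HomImmHardTwoOne.Negative.RiffleRankIdPowTwoTwo

/-!
# `¬ RiffleIdentityBound` — the riffle bridge's conjectural input is false as typed

Negative lemma of record for the crux `HomImmHardTwoOne` (item stmt-ValiantsHypothesis-30635) of route
`DepthWindow` (decomp-valiant workshop, lens 4, generation 12; requested by the critic seat, bus
2026-08-30T08:52Z, whose paper argument this file formalises).

`Theorems/DepthWindowRiffleBridge.lean` types Rossman's riffle rank (`IsRiffleBasic`, `riffleRank`,
[Rossman2025, Def. 3.1] in the reading forced by the parameter count of his Lemma 3.3(2)) and, as the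
`@[conjecture]` input of the bridge `riffleBridge`, the bound

  `RiffleIdentityBound : ∃ t n₀, 0 < t ∧ ∀ n ≥ n₀, n^{k-2-⌈log₂(k-1)⌉... } ≤ R_riffle(I_n^{⊗(k-2)})`,
  `k = ⌊√⌊log₂ n⌋⌋` (i.e. `R_riffle(I_n^{⊗k'}) ≥ n^{k' - ⌈log₂(k'+1)⌉ + ⌊log₂ k'⌋/t}`, `k' = k - 2`).

The critic's seed fact `riffleRank_idPow_two_two_le_three : riffleRank R (idPow R 2 2) ≤ 3`
(`HomImmHardTwoOne/Negative/RiffleRankIdPowTwoTwo.lean`) propagates multiplicatively in BOTH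
directions at once, by a direct product construction that avoids general closure lemmas: for
`n = 2^j` and `k' = 2i`, read `a_r ∈ [2^j]` as `j` bits and the `2i` positions as `i` consecutive pairs;
then `[a = b] = ∏_{p<i} ∏_{q<j} [ (bit_q a_{2p}, bit_q a_{2p+1}) = (bit_q b_{2p}, bit_q b_{2p+1}) ]`, each
factor is the `2 × 2 ⊗ 2` identity `= ∑_{l<3} τ_l`, and expanding the product gives
`I_{2^j}^{⊗ 2i} = ∑_{L : [i]×[j]→[3]} T_L` with every `T_L` RIFFLE-BASIC (`prodTerm_isRiffleBasic`: the factor at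
an even position `2p` is `∏_q A₁^{L(p,q)}(bit_q a_{2p})`, the factor at the odd position `2p+1` is
`∏_q A₂^{L(p,q)}(bit_q a_{2p+1} ; bit_q b_{2p})` — it reads only the `b`-index at position `2p < 2p+1`, as
Definition 3.1 allows — and `g_L(b) = ∏ g^{L(p,q)}`).  Hence

* `riffleRank_idPow_pow_le : riffleRank R (idPow R (2^j) (i*2)) ≤ 3^(j*i)` for every commutative ring
  `R` — i.e. `R_riffle(I_n^{⊗k'}) ≤ n^{(½·log₂3)·k'} = n^{0.79…·k'}` for `n` a power of two and `k'` even,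
  contradicting [Rossman2025, Conj. 1.2] (`n^{k'-o(log k')}`) under this reading of Def. 3.1;
* `not_riffleIdentityBound : ¬ RiffleIdentityBound` — at `n = 2^{m²}`, `m = 10u + 2` (`u ≥ 3`, so
  `k' = 10u`): `3^{5u·m²} < 2^{8u·m²} ≤ n^{k' - ⌈log₂(k'+1)⌉} ≤ n^{k' - ⌈log₂(k'+1)⌉ + ⌊log₂ k'⌋/t}`, using
  `3^5 < 2^8` and `⌈log₂(10u+1)⌉ ≤ 2u`.

Consequence for the route record: the hypothesis `hI : RiffleIdentityBound` of `riffleBridge` is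
refutable, so the riffle bridge into `HomImmHardTwoOne` is VACUOUS as typed (NODE-v11 §7 recorded it as a
method family «pending the identity bound»; it is now closed).  Caveat carried from the seed file: if the
display of [Rossman2025, Def. 3.1] (acq-14887) turns out narrower than Lemma 3.3's parameter count
indicates, then `IsRiffleBasic` — not the conjecture — is what this file refutes.  Nothing here bears on
`VP ≠ VNP`.

References: [Rossman2025] B. Rossman, Riffle Rank, Procedia Comput. Sci. (LAGOS 2025),
doi:10.1016/j.procs.2025.10.301, Def. 3.1, Lemma 3.2, Lemma 3.3, Question 4.1, Conj. 1.2.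
-/

-- layout Summits/ValiantsHypothesis/ValiantsHypothesis forces the duplicated namespace component
set_option linter.dupNamespace false

namespace Summit.ValiantsHypothesis.ValiantsHypothesis.Theorems.DepthWindow.Riffle.Negative

open Summit.ValiantsHypothesis.ValiantsHypothesis.Theorems.DepthWindow.Riffle Finset

universe u

variable (R : Type u) [CommRing R]

/-! ### A decomposition indexed by any finite type bounds the riffle rank -/

/-- If `t` is a sum of riffle-basic tensors indexed by a finite type `ι`, then
`riffleRank t ≤ |ι|`. [folklore] -/
theorem riffleRank_le_card {n k : ℕ} {ι : Type} [Fintype ι] (t : Tensor2 n k R)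
    (ts : ι → Tensor2 n k R) (hb : ∀ l, IsRiffleBasic R (ts l))
    (hs : ∀ a b, t a b = ∑ l, ts l a b) : riffleRank R t ≤ Fintype.card ι := by
  refine Nat.sInf_le ⟨fun l => ts ((Fintype.equivFin ι).symm l), fun l => hb _, fun a b => ?_⟩
  rw [hs a b]
  exact Fintype.sum_equiv (Fintype.equivFin ι) _ _ (fun l => by simp)

/-! ### Bits and pair-positions -/

variable {i j : ℕ}

/-- Bit `q` of `x ∈ [2^j]`, reading `[2^j] ≃ ([j] → [2])` (`finFunctionFinEquiv`). -/
def bit (x : Fin (2 ^ j)) (q : Fin j) : Fin 2 := finFunctionFinEquiv.symm x q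

/-- Two elements of `[2^j]` with the same bits are equal. [folklore] -/
theorem eq_of_bit_eq {x y : Fin (2 ^ j)} (h : ∀ q, bit x q = bit y q) : x = y :=
  finFunctionFinEquiv.symm.injective (funext h)

/-- The local index pair of `a : [2i] → [2^j]` at pair-position `p` and bit `q`: the map
`s ↦ bit_q (a_{2p+s})` (`finProdFinEquiv (p, s) = s + 2p`). -/
def loc (a : Fin (i * 2) → Fin (2 ^ j)) (p : Fin i) (q : Fin j) : Fin 2 → Fin 2 :=
  fun s => bit (a (finProdFinEquiv (p, s))) q

/-- `a = b` iff all local index pairs agree. [folklore] -/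
theorem eq_iff_loc_eq (a b : Fin (i * 2) → Fin (2 ^ j)) :
    a = b ↔ ∀ p q, loc a p q = loc b p q := by
  constructor
  · rintro rfl p q
    rfl
  · intro h
    funext r
    obtain ⟨⟨p, s⟩, rfl⟩ := finProdFinEquiv.surjective r
    exact eq_of_bit_eq fun q => congrFun (h p q) s

/-- The even position of pair `p` is `2p`. [folklore] -/
theorem val_pair_zero (p : Fin i) :
    ((finProdFinEquiv (p, (0 : Fin 2)) : Fin (i * 2)) : ℕ) = 2 * p := by
  simp [finProdFinEquiv]

/-- The odd position of pair `p` is `2p+1`. [folklore] -/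
theorem val_pair_one (p : Fin i) :
    ((finProdFinEquiv (p, (1 : Fin 2)) : Fin (i * 2)) : ℕ) = 2 * p + 1 := by
  simp [finProdFinEquiv]
  omega

/-- `(2p+1) - 1 < 2p+1`. [folklore] -/
theorem pred_lt_pair_one (p : Fin i) :
    ((finProdFinEquiv (p, (1 : Fin 2)) : Fin (i * 2)) : ℕ) - 1
      < ((finProdFinEquiv (p, (1 : Fin 2)) : Fin (i * 2)) : ℕ) := by
  rw [val_pair_one]
  omega

/-- The predecessor of the odd position of pair `p`, as an element of `[2i]`, is its even position.
[folklore] -/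
theorem castLT_pred_pair_one (p : Fin i) (h1) (h2) :
    Fin.castLT (⟨((finProdFinEquiv (p, (1 : Fin 2)) : Fin (i * 2)) : ℕ) - 1, h1⟩ :
      Fin ((finProdFinEquiv (p, (1 : Fin 2)) : Fin (i * 2)) : ℕ)) h2
      = finProdFinEquiv (p, (0 : Fin 2)) := by
  ext
  simp

/-- A product over the `2i` positions, grouped into the `i` pairs `(2p, 2p+1)`. [folklore] -/
theorem prod_pair (f : Fin (i * 2) → R) :
    ∏ r, f r = ∏ p : Fin i, (f (finProdFinEquiv (p, 0)) * f (finProdFinEquiv (p, 1))) := by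
  rw [← Fintype.prod_equiv finProdFinEquiv (fun ps => f (finProdFinEquiv ps)) f (fun _ => rfl),
    Fintype.prod_prod_type]
  simp only [Fin.prod_univ_two]

/-! ### The product terms and their riffle-basic structure -/

/-- The product term attached to a choice `L` of one witness term per (pair-position, bit):
`T_L(a,b) = ∏_{p,q} τ_{L(p,q)}(loc a p q, loc b p q)`. -/
def prodTerm (L : Fin i → Fin j → Fin 3) : Tensor2 (2 ^ j) (i * 2) R :=
  fun a b => ∏ p, ∏ q, termR R (L p q) (loc a p q) (loc b p q)

/-- Coefficient tensor of `T_L`: `g_L(b) = ∏_{p,q} g^{L(p,q)}(bit_q b_{2p}, bit_q b_{2p+1})`. -/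
def prodG (L : Fin i → Fin j → Fin 3) (b : Fin (i * 2) → Fin (2 ^ j)) : R :=
  ∏ p, ∏ q, ((g (L p q) (loc b p q) : ℤ) : R)

/-- Factor family of `T_L` in the format of `IsRiffleBasic`: at the even position `2p` the factor
`∏_q A₁^{L(p,q)}(bit_q x)` (no `b`-dependence), at the odd position `2p+1` the factor
`∏_q A₂^{L(p,q)}(bit_q x ; bit_q b_{2p})`, reading the `b`-prefix at index `2p`. -/
def prodA (L : Fin i → Fin j → Fin 3) (r : Fin (i * 2)) (x : Fin (2 ^ j))
    (bp : Fin r → Fin (2 ^ j)) : R :=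
  if (finProdFinEquiv.symm r).2 = 0 then
    ∏ q, ((A1 (L (finProdFinEquiv.symm r).1 q) (bit x q) : ℤ) : R)
  else if hr : 0 < (r : ℕ) then
    ∏ q, ((A2 (L (finProdFinEquiv.symm r).1 q) (bit x q)
      (bit (bp ⟨(r : ℕ) - 1, Nat.sub_lt hr Nat.one_pos⟩) q) : ℤ) : R)
  else 0

/-- The factor of `T_L` at the even position `2p`. [critic argument, formalised] -/
theorem prodA_zero (L : Fin i → Fin j → Fin 3) (p : Fin i) (x : Fin (2 ^ j))
    (bp : Fin ((finProdFinEquiv (p, (0 : Fin 2)) : Fin (i * 2)) : ℕ) → Fin (2 ^ j)) :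
    prodA R L (finProdFinEquiv (p, 0)) x bp = ∏ q, ((A1 (L p q) (bit x q) : ℤ) : R) := by
  unfold prodA
  rw [Equiv.symm_apply_apply]
  simp

/-- The factor of `T_L` at the odd position `2p+1` (it reads the `b`-prefix at index `2p`).
[critic argument, formalised] -/
theorem prodA_one (L : Fin i → Fin j → Fin 3) (p : Fin i) (x : Fin (2 ^ j))
    (bp : Fin ((finProdFinEquiv (p, (1 : Fin 2)) : Fin (i * 2)) : ℕ) → Fin (2 ^ j)) :
    prodA R L (finProdFinEquiv (p, 1)) x bp =
      ∏ q, ((A2 (L p q) (bit x q)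
        (bit (bp ⟨((finProdFinEquiv (p, (1 : Fin 2)) : Fin (i * 2)) : ℕ) - 1, pred_lt_pair_one p⟩) q)
          : ℤ) : R) := by
  have hr : 0 < ((finProdFinEquiv (p, (1 : Fin 2)) : Fin (i * 2)) : ℕ) := by
    rw [val_pair_one]
    omega
  unfold prodA
  rw [Equiv.symm_apply_apply, if_neg (by simp), dif_pos hr]

/-- Every product term is riffle-basic. [critic argument, formalised] -/
theorem prodTerm_isRiffleBasic (L : Fin i → Fin j → Fin 3) : IsRiffleBasic R (prodTerm R L) := by
  refine ⟨prodG R L, prodA R L, fun a b => ?_⟩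
  rw [prod_pair]
  simp only [prodA_zero, prodA_one, castLT_pred_pair_one]
  simp only [prodTerm, prodG, termR, term, loc, Int.cast_mul, Finset.prod_mul_distrib]

/-- The product terms sum to the identity tensor: `I_{2^j}^{⊗ 2i} = ∑_L T_L`.
[critic argument, formalised] -/
theorem sum_prodTerm (a b : Fin (i * 2) → Fin (2 ^ j)) :
    ∑ L : Fin i → Fin j → Fin 3, prodTerm R L a b = idPow R (2 ^ j) (i * 2) a b := by
  classical
  calc ∑ L : Fin i → Fin j → Fin 3, prodTerm R L a b
      = ∏ p, ∑ Lp : Fin j → Fin 3, ∏ q, termR R (Lp q) (loc a p q) (loc b p q) :=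
        (Fintype.prod_sum (fun p (Lp : Fin j → Fin 3) =>
          ∏ q, termR R (Lp q) (loc a p q) (loc b p q))).symm
    _ = ∏ p, ∏ q, ∑ l : Fin 3, termR R l (loc a p q) (loc b p q) := by
        refine Finset.prod_congr rfl fun p _ => ?_
        exact (Fintype.prod_sum (fun q (l : Fin 3) => termR R l (loc a p q) (loc b p q))).symm
    _ = ∏ p, ∏ q, idPow R 2 2 (loc a p q) (loc b p q) := by
        simp only [← idPow_two_two_eq_sumR]
    _ = idPow R (2 ^ j) (i * 2) a b := by
        by_cases hab : a = b
        · subst hab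
          simp [idPow]
        · obtain ⟨p, q, hpq⟩ : ∃ p q, loc a p q ≠ loc b p q := by
            by_contra hne
            exact hab ((eq_iff_loc_eq a b).2 fun p q => not_not.1 fun hpq => hne ⟨p, q, hpq⟩)
          rw [show idPow R (2 ^ j) (i * 2) a b = 0 by simp [idPow, hab]]
          apply Finset.prod_eq_zero (Finset.mem_univ p)
          apply Finset.prod_eq_zero (Finset.mem_univ q)
          simp [idPow, hpq]

/-- **`R_riffle(I_{2^j}^{⊗ 2i}) ≤ 3^{ij}`** over every commutative ring, for the typed definition:
`R_riffle(I_n^{⊗k}) ≤ n^{(½ log₂ 3)·k}` for `n` a power of two and `k` even — contradicting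
[Rossman2025, Conj. 1.2] under the reading of Def. 3.1 that `IsRiffleBasic` types.
[critic argument, formalised; cite: Rossman2025, Conj. 1.2, Question 4.1] -/
theorem riffleRank_idPow_pow_le (i j : ℕ) :
    riffleRank R (idPow R (2 ^ j) (i * 2)) ≤ 3 ^ (j * i) := by
  classical
  have h := riffleRank_le_card R (idPow R (2 ^ j) (i * 2)) (prodTerm R) (prodTerm_isRiffleBasic R)
    (fun a b => (sum_prodTerm R a b).symm)
  simpa [Fintype.card_fun, pow_mul] using h

/-! ### The exponent arithmetic and the refutation -/

/-- `⌈log₂(10u+1)⌉ ≤ 2u` for `u ≥ 3`. [folklore] -/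
theorem clog_le (u : ℕ) (hu : 3 ≤ u) : Nat.clog 2 (10 * u + 1) ≤ 2 * u := by
  rw [Nat.clog_le_iff_le_pow (by norm_num)]
  induction u, hu using Nat.le_induction with
  | base => norm_num
  | succ u hu ih =>
    have h4 : (2 : ℕ) ^ (2 * (u + 1)) = 2 ^ (2 * u) * 4 := by
      rw [show 2 * (u + 1) = 2 * u + 2 by ring, pow_add]
      norm_num
    rw [h4]
    omega

/-- **The riffle identity bound is false as typed.**  For every `t ≥ 1` and `n₀`, at
`n = 2^{m²}` with `m = 10u + 2 ≥ max(n₀, 32)` the typed bound demands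
`n^{10u - ⌈log₂(10u+1)⌉} ≤ R_riffle(I_n^{⊗ 10u}) ≤ 3^{5u·m²} < 2^{8u·m²} ≤ n^{10u - 2u}`, absurd.
[critic argument, formalised; cite: Rossman2025, Conj. 1.2] -/
theorem not_riffleIdentityBound : ¬ RiffleIdentityBound := by
  rintro ⟨t, n₀, ht, h⟩
  obtain ⟨u, hu3, hun⟩ : ∃ u : ℕ, 3 ≤ u ∧ n₀ ≤ u := ⟨n₀ + 3, by omega, by omega⟩
  obtain ⟨i, hi⟩ : ∃ i : ℕ, i = 5 * u := ⟨_, rfl⟩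
  obtain ⟨m, hm⟩ : ∃ m : ℕ, m = i * 2 + 2 := ⟨_, rfl⟩
  obtain ⟨J, hJ⟩ : ∃ J : ℕ, J = m * m := ⟨_, rfl⟩
  obtain ⟨n, hn⟩ : ∃ n : ℕ, n = 2 ^ J := ⟨_, rfl⟩
  have hmpos : 0 < m := by omega
  have hJpos : 0 < J := by
    rw [hJ]
    exact Nat.mul_pos hmpos hmpos
  have hn₀ : n₀ ≤ n := by
    calc n₀ ≤ m := by omega
      _ ≤ J := by
          rw [hJ]
          exact Nat.le_mul_self m
      _ ≤ n := by
          rw [hn]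
          exact J.lt_two_pow_self.le
  have hlog : Nat.log 2 n = J := by rw [hn, Nat.log_pow (by norm_num)]
  have hsqrt : Nat.sqrt (Nat.log 2 n) = m := by rw [hlog, hJ, Nat.sqrt_eq]
  have key := h n hn₀
  rw [hsqrt] at key
  have hm2 : m - 2 = i * 2 := by omega
  have hm1 : m - 1 = i * 2 + 1 := by omega
  rw [hm2, hm1] at key
  -- the upper bound from the product construction
  have hup : riffleRank ℂ (idPow ℂ n (i * 2)) ≤ 3 ^ (J * i) := by
    rw [hn]
    exact riffleRank_idPow_pow_le ℂ i J
  -- the exponent of the typed lower bound is at least `8u`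
  have hclog : Nat.clog 2 (i * 2 + 1) ≤ 2 * u := by
    rw [show i * 2 + 1 = 10 * u + 1 by omega]
    exact clog_le u hu3
  have hE : i * 2 - 2 * u ≤ i * 2 - Nat.clog 2 (i * 2 + 1) + Nat.log 2 (i * 2) / t := by
    generalize hC : Nat.clog 2 (i * 2 + 1) = C at hclog ⊢
    generalize hD : Nat.log 2 (i * 2) / t = D
    omega
  have hnpos : 0 < n := by
    rw [hn]
    positivity
  have h1 : n ^ (i * 2 - 2 * u) ≤ n ^ (i * 2 - Nat.clog 2 (i * 2 + 1) + Nat.log 2 (i * 2) / t) :=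
    Nat.pow_le_pow_right hnpos hE
  -- `3^(5u·J) < 2^(8u·J)`
  have hJu : J * u ≠ 0 := Nat.pos_iff_ne_zero.1 (Nat.mul_pos hJpos (by omega))
  have e1 : 3 ^ (J * i) = (3 ^ 5) ^ (J * u) := by
    rw [hi, ← pow_mul]
    congr 1
    ring
  have e2 : n ^ (i * 2 - 2 * u) = (2 ^ 8) ^ (J * u) := by
    rw [show i * 2 - 2 * u = 8 * u by omega, hn, ← pow_mul, ← pow_mul]
    congr 1
    ring
  have h3 : 3 ^ (J * i) < n ^ (i * 2 - 2 * u) := by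
    rw [e1, e2]
    exact Nat.pow_lt_pow_left (by norm_num) hJu
  exact absurd (lt_of_le_of_lt (h1.trans (key.trans hup)) h3) (lt_irrefl _)

end Summit.ValiantsHypothesis.ValiantsHypothesis.Theorems.DepthWindow.Riffle.Negative
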